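/-
Copyright (c) 2026 the pub-hodgecm-mathlib formalisation cell (harness21).  Prover seat hodgecm-mathlib-F0P3a-p03 (g21), 2026-09-02 (LH7 leaf ED. 3 road, letter O8a, step (4) = (M1)
of `F0/P3a/F0P3a-p03/g21/CENSUS-O8a-PKsaU2.F0P3ap03g21.md`: strong approximation for `SU(antidiag(1,1))` with one finite place free — part C, the unit pivot, and the head).
-/
import Literature.NumberTheory.Automorphic.UnitaryGroupAdelicTransvectionsClosure     -- ★ p850662 (this seat): part B
import Literature.NumberTheory.Automorphic.AdeleGaloisDescent                         -- ★ `AdeleRing.mem_range_baseChange_of_forall_smul_eq`, ★ `AdeleRing.smul_baseChange`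
import Literature.NumberTheory.Automorphic.StrongApproximationSL2                       -- ★ `FiniteAdeleRing.exists_isUnit_add_mul`
import Literature.NumberTheory.Automorphic.UnitaryGroupSplitPlace                       -- ★ `algEquiv_eq_one_or_eq`
import HarnessLib

/-!
# STRONG APPROXIMATION FOR `SU(antidiag(1,1))` WITH ONE FINITE PLACE FREE: `SU(J)(𝔸_F) ⊆ closure ⟨SU(J)(F), ι_{v₁} SU(J)(F_{v₁})⟩`, archimedean components included

Registry: pub-hodgecm MODEL-CONSTRUCTION sub-cell; third of the files on strong approximation for `SU(antidiag(1,1)) ≅ SL₂` (★ p850635 part A, ★ p850662 part B).  THEOREMS ONLY: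
no definition, no named fact, no instance, no notation, no `sorry`.  This is the simply-connected strong approximation theorem of Kneser–Platonov ([PlatonovRapinchuk1994] §7.4
Thm. 7.12; [Kneser1966]) for the group `SU(antidiag(1,1))_{E∕F} ≅ SL_{2,F}` with the free place `S₀ = {v₁}` a FINITE place (so the archimedean components ARE approximated) — the
number-theoretic input of the LH7 letter O8a `PKsaU2Shape` (census memo step (4) = (M1)); proved by the unit-pivot method of ★ `StrongApproximationSL2` run inside `U(J)(𝔸_F) ≤ GL₂(𝔸_E)`.

THE MATHEMATICS.  `E ∕ F` a quadratic (Galois) extension of number fields, `c ≠ 1` its automorphism (`c² = 1`), `J = antidiag(1,1) ∈ M₂(E)`, `v₁` a finite place of `F` with `w₁ ∣ v₁`,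
`θ ∈ E` with `c θ = −θ ≠ 0`; `C :=` the topological closure of `⟨toAdelic(SU(J)(F)) ∪ inclPlaceAdelic v₁(SU(J)(F_{v₁}))⟩` in `U(J)(𝔸_F)`.  By part B every unitary adelic transvection
`T_{ij}(y)`, `(c ⊗ 1) y = −y`, lies in `C`.  Let `s = (a b; c d) ∈ U(J)(𝔸_F)` with `det s = 1`; then `(c⊗1)a = a`, `(c⊗1)d = d`, `(c⊗1)b = −b`, `(c⊗1)c = −c` (★ `entries_of_mem_adelic_of_det_eq_one`).
* §1 (any commutative ring) the WORD: if `a a' = 1`, `θ θ' = 1`, `ad − bc = 1` then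
  `(a b; c d) = L(c a') · [U(θa) L(−θ'a') U(θa)] · [U(−θ) L(θ') U(−θ)] · U(a' b)` (`L = T₁₀`, `U = T₀₁`; the two brackets are `m(θa) = (0 θa; −(θa)⁻¹ 0)` and `m(−θ) = m(θ)⁻¹`,
  with `m(θa) m(θ)⁻¹ = diag(a, a⁻¹)` — Whitehead), all eight letters being `(c ⊗ 1)`-ANTI-FIXED when `a` is fixed and `b, c, θ` are anti-fixed (`word_eq`).
* §2 hence `s ∈ C` whenever its FIXED entry `a` is an idele (`mem_topologicalClosure_of_isUnit`).
* §3 the PIVOT: for a general `s` there is an anti-fixed `y` with `a + y c` an idele (`exists_isUnit_add_mul_of_conjAdele`): descend the fixed `a, d, cθ̃, bθ̃⁻¹` to `𝔸_F` (★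
  `AdeleRing.mem_range_baseChange_of_forall_smul_eq`, Galois group `{1, c}` ★ `algEquiv_eq_one_or_eq`), where `a₀ d₀ − b₁ c₁ = 1`; row-reduce over `𝔸_F` (finite part ★
  `FiniteAdeleRing.exists_isUnit_add_mul`, archimedean part place by place) to `t ∈ 𝔸_F` with `a₀ + t c₁ ∈ 𝔸_Fˣ`; `y := θ̃ · (t ⊗ 1)`.  Then `U(y) s` has idele pivot, so `U(y) s ∈ C`, and
  `s = U(−y) · U(y) s ∈ C`.
* §4 HEAD **`mem_topologicalClosure_of_det_eq_one`**: every `s ∈ U(J)(𝔸_F)` with `det s = 1` lies in `C`.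
CONSUMER (cell `hodgecm-mathlib`, crux H413, line LH7, O8a road steps (3)(5)): with ★ p850597 (`R(ι_{v₁} SU_{v₁}) = 1` on `P`), normality and left∕right (★ p850510 mechanism) ⇒ `P` is
`SU(J)(𝔸_F)`-invariant ⇒ one-dimensional (`θ ∘ det`).  HONEST LABEL: model plumbing over ★ additive strong approximation; HC_CM is proved only modulo the printed citations of that
programme until its rung 0 closes; this file proves the `SL₂`-type case of [PlatonovRapinchuk1994] Thm. 7.12 that O8a cites, for `SU(antidiag(1,1))`.

## References
* [PlatonovRapinchuk1994] V. Platonov, A. Rapinchuk, *Algebraic Groups and Number Theory* (1994), §7.4 Thm. 7.12 (strong approximation), §7.1.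
* [Kneser1966] M. Kneser, *Strong approximation*, Proc. Sympos. Pure Math. IX (1966) 187–196.
* [CasselsFrohlichANT1967] J. W. S. Cassels, A. Fröhlich (eds.), *Algebraic Number Theory* (1967), Ch. II §14–§15.
-/

set_option autoImplicit false

noncomputable section

open Matrix NumberField IsDedekindDomain Topology

namespace Literature.NumberTheory.Automorphic

/-! ## §1 The eight-letter word (any commutative ring) -/

namespace UnitaryOneOne

universe u

variable {R : Type u} [CommRing R]

/-- `T₀₁(x) = [[1, x],[0, 1]]` (plumbing). [cite: BourbakiAlgebraI1989, Ch. II §10 no. 13] -/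
private theorem tzo (x : R) : transvection (0 : Fin 2) 1 x = !![1, x; 0, 1] := by
  ext i j
  fin_cases i <;> fin_cases j <;> simp [transvection, Matrix.single]

/-- `T₁₀(y) = [[1, 0],[y, 1]]` (plumbing). [cite: BourbakiAlgebraI1989, Ch. II §10 no. 13] -/
private theorem toz (y : R) : transvection (1 : Fin 2) 0 y = !![1, 0; y, 1] := by
  ext i j
  fin_cases i <;> fin_cases j <;> simp [transvection, Matrix.single]

/-- Whitehead's `m(x) = U(x) L(−x⁻¹) U(x) = (0 x; −x⁻¹ 0)` for `x x' = 1` (plumbing). [cite: PlatonovRapinchuk1994, §7.4 (proof of Thm. 7.12, the rank-one word)] -/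
private theorem m_eq (x x' : R) (hx : x * x' = 1) :
    transvection (0 : Fin 2) 1 x * transvection (1 : Fin 2) 0 (-x') * transvection (0 : Fin 2) 1 x = !![0, x; -x', 0] := by
  rw [tzo, toz, Matrix.mul_fin_two, Matrix.mul_fin_two]
  ext i j
  fin_cases i <;> fin_cases j
  · simp only [Fin.zero_eta, Fin.isValue, of_apply, cons_val', cons_val_zero, cons_val_fin_one]; linear_combination -hx
  · simp only [Fin.zero_eta, Fin.isValue, Fin.mk_one, of_apply, cons_val', cons_val_one, cons_val_fin_one, cons_val_zero]; linear_combination (-x) * hx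
  · simp
  · simp only [Fin.mk_one, Fin.isValue, of_apply, cons_val', cons_val_one, cons_val_fin_one]; linear_combination -hx

/-- **The word**: for `a a' = 1`, `θ θ' = 1`, `a d − b c = 1`,
`L(c a') · [U(θa) L(−θ'a') U(θa)] · [U(−θ) L(θ') U(−θ)] · U(a' b) = (a b; c d)` (`m(θa) m(θ)⁻¹ = diag(a, a⁻¹)`, then `L(c∕a) diag(a, a⁻¹) U(b∕a) = (a b; c d)`).
[cite: PlatonovRapinchuk1994, §7.4 (proof of Thm. 7.12, the rank-one word)] [cite: BourbakiAlgebraI1989, Ch. III §8 no. 9] -/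
theorem word_eq (a b c d a' θ θ' : R) (ha : a * a' = 1) (hθ : θ * θ' = 1) (hdet : a * d - b * c = 1) :
    transvection (1 : Fin 2) 0 (c * a') * (transvection (0 : Fin 2) 1 (θ * a) * transvection (1 : Fin 2) 0 (-(θ' * a')) * transvection (0 : Fin 2) 1 (θ * a)) *
      (transvection (0 : Fin 2) 1 (-θ) * transvection (1 : Fin 2) 0 θ' * transvection (0 : Fin 2) 1 (-θ)) * transvection (0 : Fin 2) 1 (a' * b) = !![a, b; c, d] := by
  have h1 : (θ * a) * (θ' * a') = 1 := by linear_combination (a * a') * hθ + ha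
  have h2 : (-θ) * (-θ') = 1 := by linear_combination hθ
  rw [m_eq _ _ h1, show transvection (1 : Fin 2) 0 θ' = transvection (1 : Fin 2) 0 (-(-θ')) by rw [neg_neg], m_eq _ _ h2, toz, tzo,
    Matrix.mul_fin_two, Matrix.mul_fin_two, Matrix.mul_fin_two]
  ext i j
  fin_cases i <;> fin_cases j
  · simp only [Fin.zero_eta, Fin.isValue, of_apply, cons_val', cons_val_zero, cons_val_fin_one]; linear_combination a * hθ
  · simp only [Fin.zero_eta, Fin.isValue, Fin.mk_one, of_apply, cons_val', cons_val_one, cons_val_fin_one, cons_val_zero]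
    linear_combination (a * a' * b) * hθ + b * ha
  · simp only [Fin.mk_one, Fin.isValue, Fin.zero_eta, of_apply, cons_val', cons_val_zero, cons_val_one, cons_val_fin_one]
    linear_combination (c * a' * a) * hθ + c * ha
  · simp only [Fin.mk_one, Fin.isValue, of_apply, cons_val', cons_val_one, cons_val_fin_one]
    linear_combination (c * a' * a * a' * b + a') * hθ + (c * a' * b + d) * ha - a' * hdet

end UnitaryOneOne

namespace UnitaryGroup

variable (F E : Type) [Field F] [NumberField F] [Field E] [NumberField E] [Algebra F E]
variable (c : E ≃ₐ[F] E)

/-! ## §2 A determinant-one element with IDELE fixed entry lies in `C` -/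

/-- **Idele pivot ⇒ in the closure.**  `c² = 1`, `J = antidiag(1,1)`, `w₁ ∣ v₁`, `θ ∈ E` anti-fixed `≠ 0`.  If `s = (a b; c d) ∈ U(J)(𝔸_F)` has `det s = 1` and `a ∈ 𝔸_Eˣ`, then `s` lies in the
topological closure `C` of `⟨toAdelic(SU(J)(F)) ∪ inclPlaceAdelic v₁(SU(J)(F_{v₁}))⟩`: `s` is the eight-letter word of §1 in unitary adelic transvections with ANTI-FIXED parameters
`c a⁻¹, θa, −(θa)⁻¹, θa, −θ, θ⁻¹, −θ, a⁻¹ b` (★ `entries_of_mem_adelic_of_det_eq_one`), each of which lies in `C` by part B ★ `units_transvection_mem_topologicalClosure`.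
[cite: PlatonovRapinchuk1994, §7.4 Thm. 7.12 (proof)] -/
theorem mem_topologicalClosure_of_isUnit (hcc : c * c = 1) {J : Matrix (Fin 2) (Fin 2) E} (hJ2 : J = !![0, 1; 1, 0]) {v₁ : HeightOneSpectrum (𝓞 F)} (w₁ : PlacesOver E v₁)
    {θ : E} (hθ : c θ = -θ) (hθ0 : θ ≠ 0) (s : ↥(adelic F E c 2 J)) (hdet : ((s : GL (Fin 2) (AdeleRing (𝓞 E) E)) : Matrix (Fin 2) (Fin 2) (AdeleRing (𝓞 E) E)).det = 1)
    (ha : IsUnit (((s : GL (Fin 2) (AdeleRing (𝓞 E) E)) : Matrix (Fin 2) (Fin 2) (AdeleRing (𝓞 E) E)) 0 0)) :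
    s ∈ (Subgroup.closure (toAdelic F E c 2 J '' {γ : rational F E c 2 J | ((γ : GL (Fin 2) E) : Matrix (Fin 2) (Fin 2) E).det = 1} ∪
        inclPlaceAdelic F E c 2 J v₁ '' {u : ↥(localPi E c 2 J v₁) |
          ∀ w : PlacesOver E v₁, (((u : LocalGLPi E 2 v₁) w : GL (Fin 2) (w.1.adicCompletion E)) : Matrix (Fin 2) (Fin 2) (w.1.adicCompletion E)).det = 1})).topologicalClosure := by
  -- names for the entries and inverses
  obtain ⟨hσa, hσb, hσc, -⟩ := entries_of_mem_adelic_of_det_eq_one F E c hJ2 s.2 hdet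
  set A := AdeleRing (𝓞 E) E
  set a := ((s : GL (Fin 2) A) : Matrix (Fin 2) (Fin 2) A) 0 0 with ha_def
  set b := ((s : GL (Fin 2) A) : Matrix (Fin 2) (Fin 2) A) 0 1 with hb_def
  set cc := ((s : GL (Fin 2) A) : Matrix (Fin 2) (Fin 2) A) 1 0 with hc_def
  set d := ((s : GL (Fin 2) A) : Matrix (Fin 2) (Fin 2) A) 1 1 with hd_def
  obtain ⟨a', ha'⟩ := ha.exists_right_inv
  set θA : A := algebraMap E A θ with hθA
  set θ' : A := algebraMap E A θ⁻¹ with hθ'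
  have hθθ : θA * θ' = 1 := by rw [hθA, hθ', ← map_mul, mul_inv_cancel₀ hθ0, map_one]
  have hdet' : a * d - b * cc = 1 := by rw [Matrix.det_fin_two] at hdet; exact hdet
  -- anti-fixedness of the eight parameters
  have hσθ : conjAdele F E c θA = -θA := conjAdele_algebraMap_of_map_eq_neg F E c hθ
  have hσθ' : conjAdele F E c θ' = -θ' := conjAdele_algebraMap_of_map_eq_neg F E c (by rw [map_inv₀, hθ, inv_neg])
  have hσa' : conjAdele F E c a' = a' := by
    have h1 : conjAdele F E c a' * a = 1 := by
      conv_lhs => rw [← hσa]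
      rw [← map_mul, mul_comm a' a, ha', map_one]
    calc conjAdele F E c a' = conjAdele F E c a' * (a * a') := by rw [ha', mul_one]
      _ = a' := by rw [← mul_assoc, h1, one_mul]
  have p1 : conjAdele F E c (cc * a') = -(cc * a') := by rw [map_mul, hσc, hσa', neg_mul]
  have p2 : conjAdele F E c (θA * a) = -(θA * a) := by rw [map_mul, hσθ, hσa, neg_mul]
  have p3 : conjAdele F E c (-(θ' * a')) = -(-(θ' * a')) := by rw [map_neg, map_mul, hσθ', hσa', neg_mul]
  have p5 : conjAdele F E c (-θA) = -(-θA) := by rw [map_neg, hσθ]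
  have p8 : conjAdele F E c (a' * b) = -(a' * b) := by rw [map_mul, hσa', hσb, mul_neg]
  -- the letters, as elements of `U(J)(𝔸_F)`, all in `C`
  have hL : ∀ (i j : Fin 2) (hij : i ≠ j) (y : A) (hy : conjAdele F E c y = -y),
      (⟨⟨(⟨i, j, hij, y⟩ : TransvectionStruct (Fin 2) A).toMatrix, (⟨i, j, hij, y⟩ : TransvectionStruct (Fin 2) A).inv.toMatrix,
          TransvectionStruct.mul_inv _, TransvectionStruct.inv_mul _⟩, units_transvection_mem_adelic F E c hJ2 ⟨i, j, hij, y⟩ hy⟩ : ↥(adelic F E c 2 J)) ∈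
        (Subgroup.closure (toAdelic F E c 2 J '' {γ : rational F E c 2 J | ((γ : GL (Fin 2) E) : Matrix (Fin 2) (Fin 2) E).det = 1} ∪
          inclPlaceAdelic F E c 2 J v₁ '' {u : ↥(localPi E c 2 J v₁) |
            ∀ w : PlacesOver E v₁, (((u : LocalGLPi E 2 v₁) w : GL (Fin 2) (w.1.adicCompletion E)) : Matrix (Fin 2) (Fin 2) (w.1.adicCompletion E)).det = 1})).topologicalClosure :=
    fun i j hij y hy => units_transvection_mem_topologicalClosure F E c hcc hJ2 w₁ i j hij y hy
  have h01 : (0 : Fin 2) ≠ 1 := by decide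
  have h10 : (1 : Fin 2) ≠ 0 := by decide
  -- the word
  have hprod := mul_mem (mul_mem (mul_mem (hL 1 0 h10 _ p1) (mul_mem (mul_mem (hL 0 1 h01 _ p2) (hL 1 0 h10 _ p3)) (hL 0 1 h01 _ p2)))
    (mul_mem (mul_mem (hL 0 1 h01 _ p5) (hL 1 0 h10 _ hσθ')) (hL 0 1 h01 _ p5))) (hL 0 1 h01 _ p8)
  convert hprod using 1
  refine Subtype.ext (Units.ext ?_)
  simp only [Subgroup.coe_mul, Units.val_mul]
  change ((s : GL (Fin 2) A) : Matrix (Fin 2) (Fin 2) A) =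
    transvection (1 : Fin 2) 0 (cc * a') * (transvection (0 : Fin 2) 1 (θA * a) * transvection (1 : Fin 2) 0 (-(θ' * a')) * transvection (0 : Fin 2) 1 (θA * a)) *
      (transvection (0 : Fin 2) 1 (-θA) * transvection (1 : Fin 2) 0 θ' * transvection (0 : Fin 2) 1 (-θA)) * transvection (0 : Fin 2) 1 (a' * b)
  rw [UnitaryOneOne.word_eq a b cc d a' θA θ' ha' hθθ hdet']
  exact Matrix.eta_fin_two _

/-! ## §3 The pivot: an anti-fixed `y` with `a + y c` an idele -/

omit [NumberField F] [NumberField E] in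
/-- row reduction over `F_∞ = ∏_{v ∣ ∞} F_v`: for `a d − b c = 1` there is `t` with `a + t c` a unit (place by place: `t_v = 0` if `a_v ≠ 0`, else `c_v⁻¹`). [folklore] -/
private theorem InfiniteAdeleRing.exists_isUnit_add_mul {a b c d : InfiniteAdeleRing F} (hdet : a * d - b * c = 1) :
    ∃ t : InfiniteAdeleRing F, IsUnit (a + t * c) := by
  classical
  refine ⟨fun v => if a v = 0 then (c v)⁻¹ else 0, Pi.isUnit_iff.2 fun v => ?_⟩
  have hv : a v * d v - b v * c v = 1 := congrFun hdet v
  change IsUnit (a v + (if a v = 0 then (c v)⁻¹ else 0) * c v)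
  by_cases h0 : a v = 0
  · have hc0 : c v ≠ 0 := by
      intro hc
      rw [h0, hc, zero_mul, mul_zero, sub_zero] at hv
      exact zero_ne_one hv
    rw [if_pos h0, h0, zero_add, inv_mul_cancel₀ hc0]
    exact isUnit_one
  · rw [if_neg h0, zero_mul, add_zero]
    exact isUnit_iff_ne_zero.2 h0

omit [NumberField E] in
/-- row reduction over the full adele ring `𝔸_F = F_∞ × 𝔸_F^∞` (★ `FiniteAdeleRing.exists_isUnit_add_mul` + the archimedean places). [cite: CasselsFrohlichANT1967, Ch. II §14] -/
private theorem AdeleRing.exists_isUnit_add_mul {a b c d : AdeleRing (𝓞 F) F} (hdet : a * d - b * c = 1) :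
    ∃ t : AdeleRing (𝓞 F) F, IsUnit (a + t * c) := by
  obtain ⟨t₁, ht₁⟩ := InfiniteAdeleRing.exists_isUnit_add_mul F (a := a.1) (b := b.1) (c := c.1) (d := d.1) (congrArg Prod.fst hdet)
  obtain ⟨t₂, ht₂⟩ := FiniteAdeleRing.exists_isUnit_add_mul (R := 𝓞 F) (K := F) (a := a.2) (b := b.2) (c := c.2) (d := d.2) (congrArg Prod.snd hdet)
  exact ⟨(t₁, t₂), Prod.isUnit_iff.2 ⟨ht₁, ht₂⟩⟩

variable [Algebra.IsQuadraticExtension F E] [IsGalois F E]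

omit [IsGalois F E] in
/-- in a quadratic extension every automorphism is `1` or `c`, so `c`-fixed means Galois-fixed (★ `algEquiv_eq_one_or_eq`). [folklore] -/
private theorem forall_smul_eq_of_smul_eq (hc : c ≠ 1) {x : AdeleRing (𝓞 E) E} (hx : c • x = x) : ∀ σ : E ≃ₐ[F] E, σ • x = x := fun σ => by
  rcases algEquiv_eq_one_or_eq F hc σ with rfl | rfl
  · exact one_smul _ x
  · exact hx

/-- **THE PIVOT.**  `E ∕ F` quadratic Galois, `c ≠ 1`, `J = antidiag(1,1)`, `θ` anti-fixed `≠ 0`; for `s = (a b; c d) ∈ U(J)(𝔸_F)` with `det s = 1` there is an ANTI-FIXED `y ∈ 𝔸_E` with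
`a + y c ∈ 𝔸_Eˣ` — `y = θ̃ · (t ⊗ 1)` where `t ∈ 𝔸_F` row-reduces the DESCENDED matrix `(a₀, b θ̃⁻¹; c θ̃, d₀)` of determinant `1` over `𝔸_F` (the fixed adeles `a, d, cθ̃, bθ̃⁻¹` descend
by ★ `AdeleRing.mem_range_baseChange_of_forall_smul_eq`). [cite: PlatonovRapinchuk1994, §7.4 Thm. 7.12 (proof)] [cite: CasselsFrohlichANT1967, Ch. II §14] -/
theorem exists_isUnit_add_mul_of_conjAdele (hc : c ≠ 1) {J : Matrix (Fin 2) (Fin 2) E} (hJ2 : J = !![0, 1; 1, 0]) {θ : E} (hθ : c θ = -θ) (hθ0 : θ ≠ 0)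
    (s : ↥(adelic F E c 2 J)) (hdet : ((s : GL (Fin 2) (AdeleRing (𝓞 E) E)) : Matrix (Fin 2) (Fin 2) (AdeleRing (𝓞 E) E)).det = 1) :
    ∃ y : AdeleRing (𝓞 E) E, conjAdele F E c y = -y ∧
      IsUnit (((s : GL (Fin 2) (AdeleRing (𝓞 E) E)) : Matrix (Fin 2) (Fin 2) (AdeleRing (𝓞 E) E)) 0 0 +
        y * ((s : GL (Fin 2) (AdeleRing (𝓞 E) E)) : Matrix (Fin 2) (Fin 2) (AdeleRing (𝓞 E) E)) 1 0) := by
  obtain ⟨hσa, hσb, hσc, hσd⟩ := entries_of_mem_adelic_of_det_eq_one F E c hJ2 s.2 hdet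
  rw [Matrix.det_fin_two] at hdet
  set A := AdeleRing (𝓞 E) E
  set a := ((s : GL (Fin 2) A) : Matrix (Fin 2) (Fin 2) A) 0 0
  set b := ((s : GL (Fin 2) A) : Matrix (Fin 2) (Fin 2) A) 0 1
  set cc := ((s : GL (Fin 2) A) : Matrix (Fin 2) (Fin 2) A) 1 0
  set d := ((s : GL (Fin 2) A) : Matrix (Fin 2) (Fin 2) A) 1 1
  set θA : A := algebraMap E A θ with hθA
  set θ' : A := algebraMap E A θ⁻¹ with hθ'
  have hθθ : θA * θ' = 1 := by rw [hθA, hθ', ← map_mul, mul_inv_cancel₀ hθ0, map_one]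
  have hσθ : conjAdele F E c θA = -θA := conjAdele_algebraMap_of_map_eq_neg F E c hθ
  have hσθ' : conjAdele F E c θ' = -θ' := conjAdele_algebraMap_of_map_eq_neg F E c (by rw [map_inv₀, hθ, inv_neg])
  -- the four fixed adeles and their descents to `𝔸_F`
  have fix : ∀ x : A, conjAdele F E c x = x → ∃ x₀ : AdeleRing (𝓞 F) F, AdeleRing.baseChange F E x₀ = x := fun x hx =>
    AdeleRing.mem_range_baseChange_of_forall_smul_eq F E (forall_smul_eq_of_smul_eq F E c hc hx)
  obtain ⟨a₀, ha₀⟩ := fix a hσa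
  obtain ⟨d₀, hd₀⟩ := fix d hσd
  obtain ⟨c₁, hc₁⟩ := fix (cc * θA) (by rw [map_mul, hσc, hσθ, neg_mul_neg])
  obtain ⟨b₁, hb₁⟩ := fix (b * θ') (by rw [map_mul, hσb, hσθ', neg_mul_neg])
  have hdet₀ : a₀ * d₀ - b₁ * c₁ = 1 := by
    apply AdeleRing.baseChange_injective F E
    rw [map_sub, map_mul, map_mul, map_one, ha₀, hd₀, hb₁, hc₁]
    linear_combination hdet - (b * cc) * hθθ
  obtain ⟨t, ht⟩ := AdeleRing.exists_isUnit_add_mul F hdet₀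
  refine ⟨θA * AdeleRing.baseChange F E t, ?_, ?_⟩
  · rw [map_mul, hσθ, conjAdele_apply, AdeleRing.smul_baseChange, neg_mul]
  · have key : a + θA * AdeleRing.baseChange F E t * cc = AdeleRing.baseChange F E (a₀ + t * c₁) := by
      rw [map_add, map_mul, ha₀, hc₁]; ring
    rw [key]
    exact ht.map _

/-! ## §4 HEAD: strong approximation for `SU(antidiag(1,1))` with the finite place `v₁` free -/

/-- **STRONG APPROXIMATION FOR `SU(antidiag(1,1))`, ONE FINITE PLACE FREE.**  `E ∕ F` a quadratic Galois extension of number fields with non-trivial automorphism `c`, `J = antidiag(1,1)`,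
`v₁` a finite place of `F`.  Every `s ∈ U(J)(𝔸_F)` with `det s = 1` lies in the topological closure of the subgroup of `U(J)(𝔸_F)` generated by `toAdelic(SU(J)(F))` (determinant-one
rational points) and `inclPlaceAdelic v₁(SU(J)(F_{v₁}))` (determinant-one elements at `v₁`) — ARCHIMEDEAN COMPONENTS INCLUDED: `SU(J)(F) · SU(J)(F_{v₁})` is dense in `SU(J)(𝔸_F)`.
(§3 pivot `y`; `U(y) s` has idele fixed entry, so lies in `C` by §2; `U(y) ∈ C` by part B; `s = U(y)⁻¹ (U(y) s)`.)  The `SL₂`-type case of Kneser–Platonov strong approximation cited by the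
LH7 letter O8a. [cite: PlatonovRapinchuk1994, §7.4 Thm. 7.12] [cite: Kneser1966, Hauptsatz] -/
theorem mem_topologicalClosure_of_det_eq_one (hc : c ≠ 1) {J : Matrix (Fin 2) (Fin 2) E} (hJ2 : J = !![0, 1; 1, 0]) {v₁ : HeightOneSpectrum (𝓞 F)} (w₁ : PlacesOver E v₁)
    (s : ↥(adelic F E c 2 J)) (hdet : ((s : GL (Fin 2) (AdeleRing (𝓞 E) E)) : Matrix (Fin 2) (Fin 2) (AdeleRing (𝓞 E) E)).det = 1) :
    s ∈ (Subgroup.closure (toAdelic F E c 2 J '' {γ : rational F E c 2 J | ((γ : GL (Fin 2) E) : Matrix (Fin 2) (Fin 2) E).det = 1} ∪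
        inclPlaceAdelic F E c 2 J v₁ '' {u : ↥(localPi E c 2 J v₁) |
          ∀ w : PlacesOver E v₁, (((u : LocalGLPi E 2 v₁) w : GL (Fin 2) (w.1.adicCompletion E)) : Matrix (Fin 2) (Fin 2) (w.1.adicCompletion E)).det = 1})).topologicalClosure := by
  have hcc : c * c = 1 := algEquiv_mul_self_eq_one F hc
  -- an anti-fixed `θ ≠ 0`
  have hx : ∃ x : E, c x ≠ x := by
    by_contra h
    push Not at h
    exact hc (AlgEquiv.ext h)
  obtain ⟨x, hx⟩ := hx
  have hθ : c (x - c x) = -(x - c x) := by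
    rw [map_sub, show c (c x) = x by rw [← AlgEquiv.mul_apply, hcc, AlgEquiv.one_apply], neg_sub]
  have hθ0 : x - c x ≠ 0 := sub_ne_zero.2 hx.symm
  -- the pivot
  obtain ⟨y, hy, hunit⟩ := exists_isUnit_add_mul_of_conjAdele F E c hc hJ2 hθ hθ0 s hdet
  have h01 : (0 : Fin 2) ≠ 1 := by decide
  set U : ↥(adelic F E c 2 J) := ⟨⟨(⟨0, 1, h01, y⟩ : TransvectionStruct (Fin 2) (AdeleRing (𝓞 E) E)).toMatrix,
      (⟨0, 1, h01, y⟩ : TransvectionStruct (Fin 2) (AdeleRing (𝓞 E) E)).inv.toMatrix, TransvectionStruct.mul_inv _, TransvectionStruct.inv_mul _⟩,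
    units_transvection_mem_adelic F E c hJ2 ⟨0, 1, h01, y⟩ hy⟩ with hU
  have hUC := units_transvection_mem_topologicalClosure F E c hcc hJ2 w₁ 0 1 h01 y hy
  -- `U(y) · s` has determinant one and idele pivot
  have hdet' : (((U * s : ↥(adelic F E c 2 J)) : GL (Fin 2) (AdeleRing (𝓞 E) E)) : Matrix (Fin 2) (Fin 2) (AdeleRing (𝓞 E) E)).det = 1 := by
    rw [Subgroup.coe_mul, Units.val_mul, Matrix.det_mul, hdet, mul_one]
    exact det_transvection_of_ne 0 1 h01 y
  have hpiv : IsUnit ((((U * s : ↥(adelic F E c 2 J)) : GL (Fin 2) (AdeleRing (𝓞 E) E)) : Matrix (Fin 2) (Fin 2) (AdeleRing (𝓞 E) E)) 0 0) := by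
    rw [Subgroup.coe_mul, Units.val_mul]
    change IsUnit ((transvection (0 : Fin 2) 1 y * ((s : GL (Fin 2) (AdeleRing (𝓞 E) E)) : Matrix (Fin 2) (Fin 2) (AdeleRing (𝓞 E) E))) 0 0)
    rw [transvection_mul_apply_same]
    exact hunit
  have hUs := mem_topologicalClosure_of_isUnit F E c hcc hJ2 w₁ hθ hθ0 (U * s) hdet' hpiv
  -- `s = U⁻¹ (U s)`
  have hs : s = U⁻¹ * (U * s) := by rw [inv_mul_cancel_left]
  rw [hs]
  exact mul_mem (inv_mem hUC) hUs

end UnitaryGroup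

/-! ## §5 (ED. 2) The CM dress: `F = L⁺`, `E = L`, `c` = complex conjugation, `J = Φ₂` in the H413 spelling -/

namespace UnitaryGroup

/-- **STRONG APPROXIMATION FOR `SU(Φ₂)` OVER A CM FIELD, ONE FINITE PLACE FREE** — the instance of `mem_topologicalClosure_of_det_eq_one` at `(L⁺, L, complex conjugation)` with `Φ₂` in the
literal spelling of the H413 letters (`Matrix.of fun i j : Fin 2 => if i.val + j.val + 1 = 2 then 1 else 0`): every determinant-one element of `U(Φ₂)(𝔸_{L⁺})` lies in the topological
closure of `⟨toAdelic(SU(Φ₂)(L⁺)) ∪ inclPlaceAdelic v₁(SU(Φ₂)(L⁺_{v₁}))⟩`.  (`IsGalois L⁺ L` and `Algebra.IsQuadraticExtension L⁺ L` from ★ `IsCMField.isQuadraticExtension`; `c ≠ 1` ★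
`IsCMField.complexConj_ne_one`.)  The (M1) binder of the O8a assembly, ready to `exact`. [cite: PlatonovRapinchuk1994, §7.4 Thm. 7.12] [cite: Kneser1966, Hauptsatz] -/
theorem cm_mem_topologicalClosure_of_det_eq_one (L : Type) [Field L] [NumberField L] [IsCMField L]
    {v₁ : HeightOneSpectrum (𝓞 ↥(maximalRealSubfield L))} (w₁ : PlacesOver L v₁)
    (s : ↥(adelic ↥(maximalRealSubfield L) L (IsCMField.complexConj L) 2 (Matrix.of fun i j : Fin 2 => if i.val + j.val + 1 = 2 then (1 : L) else 0)))
    (hdet : ((s : GL (Fin 2) (AdeleRing (𝓞 L) L)) : Matrix (Fin 2) (Fin 2) (AdeleRing (𝓞 L) L)).det = 1) :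
    s ∈ (Subgroup.closure
        (toAdelic ↥(maximalRealSubfield L) L (IsCMField.complexConj L) 2 (Matrix.of fun i j : Fin 2 => if i.val + j.val + 1 = 2 then (1 : L) else 0) ''
            {γ : rational ↥(maximalRealSubfield L) L (IsCMField.complexConj L) 2 (Matrix.of fun i j : Fin 2 => if i.val + j.val + 1 = 2 then (1 : L) else 0) |
              ((γ : GL (Fin 2) L) : Matrix (Fin 2) (Fin 2) L).det = 1} ∪
          inclPlaceAdelic ↥(maximalRealSubfield L) L (IsCMField.complexConj L) 2 (Matrix.of fun i j : Fin 2 => if i.val + j.val + 1 = 2 then (1 : L) else 0) v₁ ''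
            {u : ↥(localPi L (IsCMField.complexConj L) 2 (Matrix.of fun i j : Fin 2 => if i.val + j.val + 1 = 2 then (1 : L) else 0) v₁) |
              ∀ w : PlacesOver L v₁, (((u : LocalGLPi L 2 v₁) w : GL (Fin 2) (w.1.adicCompletion L)) : Matrix (Fin 2) (Fin 2) (w.1.adicCompletion L)).det = 1})).topologicalClosure := by
  haveI : Algebra.IsQuadraticExtension ↥(maximalRealSubfield L) L := IsCMField.isQuadraticExtension L
  exact mem_topologicalClosure_of_det_eq_one ↥(maximalRealSubfield L) L (IsCMField.complexConj L) (IsCMField.complexConj_ne_one L)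
    (by ext i j; fin_cases i <;> fin_cases j <;> rfl) w₁ s hdet

end UnitaryGroup

end Literature.NumberTheory.Automorphic

end
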